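import Summits.HodgeConjecture.HodgeConjecture.Theses.NikulinTwinTransport
import Literature.AlgebraicGeometry.Surfaces.K3PeriodSurjectivityProofs

/-!
# Route NikulinTwinTransport · crux `HodgeSimilitudeAlgebraic` (stmt-HodgeConjecture-13676) —
# line `kummer-bkr-quaternion-carrier`, stub `stub_kummerFrame` (an explicit Kummer frame)

Stub 2a of the line's skeleton: the tree's K3 lattice `Λ = (K3Index → ℤ, k3Gram) = E₈(−1)² ⊕ U³`
contains a KUMMER FRAME `(u, e)` — `u k s` (`k < 3`, `s < 2`) a standard basis of a sublattice
`U(2)³`, `e a` (`a < 16`) sixteen pairwise orthogonal `(−2)`-vectors orthogonal to `u`, the five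
Reed–Muller half-sums `½ Σ_{Bit[k,a]=1} e_a` (`k < 4`) and `½ Σ_a e_a` integral, and the saturation of
`⟨e_a⟩` glued EXACTLY by `RM(1,4)` (`2v = Σ y_a e_a ⇒ ȳ ∈ RM(1,4)`). This is the shape of
`H²(Km A, ℤ) ⊇ π_* H²(A, ℤ) ⊕ K = U(2)³ ⊕ K`, `K` the (primitive) Kummer lattice — Nikulin 1975,
Morrison 1984 §3 — and it is the datum `KummerFrame[u, e]` consumed by `stub_kummerSimilitude`,
`stub_kummerAnchor` and `stub_anchoredTransport` of the same line.

## Mathematics / proof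

A pure lattice CERTIFICATE. The 22 frame vectors are the columns of two integer matrices
`FU : Matrix K3Index (Fin 6) ℤ` (columns `2k + s ↦ u k s`) and `FE : Matrix K3Index (Fin 16) ℤ`
(columns `e a`), each given by five literal blocks along
`K3Index = (Fin 8 ⊕ Fin 8) ⊕ (Fin 2 ⊕ (Fin 2 ⊕ Fin 2))` (entries in `[−8, 8]`; found by gluing the
abstract Kummer K3 lattice, splitting off `U³` and identifying the complement with `E₈(−1)²` through
its root system, then re-verified in exact arithmetic).

* Clauses (1)–(3) (the Gram matrix of the frame is `U(2)³ ⊥ (−2)·1₁₆`): `IntForm` of two columns is an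
  entry of `Xᵀ · k3Gram · Y` (`intForm_col`), which for row-partitioned `X, Y` is the sum of the five
  block products (`gram_blocks`, Mathlib's `fromCols_mul_fromBlocks` / `fromCols_mul_fromRows`); the
  three block identities `FUᵀΛFU = U(2)³`, `FUᵀΛFE = 0`, `FEᵀΛFE = −2·1` are closed by `decide`
  (kernel evaluation of integer matrix products, as in `NikulinTwinTransportEEightTwoSimilitude`).
* Clauses (4), (5) (the `RM(1,4)` half-sums are integral): explicit vectors `g`, identities by `decide`.
* Clause (6) (saturation): `2v = Σ_a y_a e_a` read in the coordinate `i` says that the `i`-th ROW of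
  `FE` is a parity check on `ȳ`; eleven rows of `FE` reduce mod 2 to a basis of
  `RM(2,4) = RM(1,4)^⊥` (the extended Hamming code), so `ȳ ∈ RM(1,4)`, i.e. `y` is affine mod 2 with
  coefficients `c₀ = y 0`, `c_k = y (2^k) − y 0`; the sixteen resulting parity goals are linear and
  closed by `omega` from the eleven row identities.

Sources: Nikulin, *On Kummer surfaces* (1975); Morrison 1984 §3 (the Kummer lattice `K`, primitive
embedding `K ⊕ U(2)³ ⊂ Λ`); pattern files `NikulinTwinTransportEEightTwoSimilitude`,
`NikulinTwinTransportHodgeSimilitudeAlgebraicLattice` (literal integer matrices, `decide`).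
-/

noncomputable section

open scoped Matrix
open Literature.AlgebraicGeometry.Surfaces

namespace Summit.HodgeConjecture.HodgeConjecture.Theorems.NikulinTwinTransport.KummerBkrQuaternionCarrier

/-! ## Local notations (the first four verbatim from the line's skeleton) -/

/-- `IntForm[v, w] = vᵀ Λ w`, the integral K3 lattice form (as in `PeriodPt`). Local notation only. -/
local notation3 (prettyPrint := false) "IntForm[" v ", " w "]" =>
  (∑ i : K3Index, ∑ j : K3Index, (v : K3Index → ℤ) i * k3Gram i j * (w : K3Index → ℤ) j)

/-- `Bit[k, a] ∈ {0, 1} ⊂ ℤ`: the `k`-th binary digit of `a : Fin 16` — the identification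
`Fin 16 = 𝔽₂⁴` under which the Reed–Muller code `RM(1,4)` is the space of affine functions (Nikulin's
description of the Kummer overlattice: `A[2]` as an affine `𝔽₂⁴`). Local notation only. -/
local notation3 (prettyPrint := false) "Bit[" k ", " a "]" =>
  (((Fin.val (a : Fin 16) / 2 ^ Fin.val (k : Fin 4)) % 2 : ℕ) : ℤ)

/-- `AffineMod2[y]`: the integer vector `y : Fin 16 → ℤ` reduces mod 2 to a codeword of `RM(1,4)`,
i.e. to an affine function `a ↦ c₀ + Σ_k c_k·Bit[k,a]` on `𝔽₂⁴`. Local notation only. -/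
local notation3 (prettyPrint := false) "AffineMod2[" y "]" =>
  (∃ (c₀ : ℤ) (c : Fin 4 → ℤ), ∀ a : Fin 16,
    (2 : ℤ) ∣ (y : Fin 16 → ℤ) a - c₀ - ∑ k : Fin 4, c k * Bit[k, a])

/-- `KummerFrame[u, e]`: a KUMMER FRAME of the K3 lattice `Λ = (K3Index → ℤ, k3Gram)` — `u k s`
(`k < 3`, `s < 2`) a standard basis of a sublattice `U(2)³` (`(u k 0 . u k 1) = 2`, all other products
`0`), `e a` (`a < 16`) sixteen pairwise orthogonal `(−2)`-vectors orthogonal to `u`, the five `RM(1,4)`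
half-sums `½ Σ_{Bit[k,a]=1} e_a` (`k < 4`) and `½ Σ_a e_a` integral, and the saturation of `⟨e⟩` glued
EXACTLY by `RM(1,4)` (`2v = Σ y_a e_a ⇒ ȳ ∈ RM(1,4)`: the Kummer lattice `K` is primitive, so a K3 whose
period is orthogonal to `e` is a Kummer surface with the `e_a` its sixteen nodal classes up to sign —
Nikulin 1975). `π_* H²(A, ℤ) = U(2)³ = K^⊥`. Local notation only. -/
local notation3 (prettyPrint := false) "KummerFrame[" u ", " e "]" =>
  ((∀ (k l : Fin 3) (s t : Fin 2),
      IntForm[(u : Fin 3 → Fin 2 → K3Index → ℤ) k s, u l t] = if k = l ∧ s ≠ t then 2 else 0) ∧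
    (∀ (k : Fin 3) (s : Fin 2) (a : Fin 16), IntForm[u k s, (e : Fin 16 → K3Index → ℤ) a] = 0) ∧
    (∀ a b : Fin 16, IntForm[e a, e b] = if a = b then -2 else 0) ∧
    (∀ k : Fin 4, ∃ g : K3Index → ℤ,
      2 • g = ∑ a : Fin 16, (if (Fin.val a / 2 ^ Fin.val k) % 2 = 1 then e a else 0)) ∧
    (∃ g : K3Index → ℤ, 2 • g = ∑ a : Fin 16, e a) ∧
    (∀ (v : K3Index → ℤ) (y : Fin 16 → ℤ), 2 • v = ∑ a : Fin 16, y a • e a → AffineMod2[y]))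

/-! ## The frame data: `FU` (columns `u k s` at index `2k + s`) and `FE` (columns `e a`), by blocks
along `K3Index = (Fin 8 ⊕ Fin 8) ⊕ (Fin 2 ⊕ (Fin 2 ⊕ Fin 2))` -/

/-- First `E₈(−1)` block of the `U(2)³` frame vectors (rows: Bourbaki simple-root coordinates). Local notation only. -/
local notation3 (prettyPrint := false) "AU1" => (!![0, 1, 0, 3, 0, 0; 0, 2, 0, 4, 0, 0;
    0, 1, 0, 5, 0, 0; 0, 2, 0, 7, 0, -1; 0, 2, 0, 6, 0, -1; 0, 1, 0, 4, 0, -1;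
    0, 1, 0, 2, 0, -2; 0, 1, 0, 1, 0, -1] : Matrix (Fin 8) (Fin 6) ℤ)

/-- Second `E₈(−1)` block of the `U(2)³` frame vectors. Local notation only. -/
local notation3 (prettyPrint := false) "AU2" => (!![0, -2, 0, -2, 0, -2; 0, -2, 0, -2, 0, -4;
    0, -3, 0, -4, 0, -5; 0, -4, 0, -5, 0, -8; 0, -2, 0, -4, 0, -7; 0, -2, 0, -4, 0, -6;
    0, -1, 0, -3, 0, -4; 0, -1, 0, -2, 0, -2] : Matrix (Fin 8) (Fin 6) ℤ)

/-- First `U` block of the `U(2)³` frame vectors. Local notation only. -/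
local notation3 (prettyPrint := false) "CU1" =>
  (!![1, 2, 0, 0, 0, 0; 0, 2, 0, 0, 0, 0] : Matrix (Fin 2) (Fin 6) ℤ)

/-- Second `U` block of the `U(2)³` frame vectors. Local notation only. -/
local notation3 (prettyPrint := false) "CU2" =>
  (!![0, 2, 1, 2, 0, 0; 0, 0, 0, 2, 0, 0] : Matrix (Fin 2) (Fin 6) ℤ)

/-- Third `U` block of the `U(2)³` frame vectors. Local notation only. -/
local notation3 (prettyPrint := false) "CU3" =>
  (!![0, 0, 0, 2, 1, 2; 0, 0, 0, 0, 0, 2] : Matrix (Fin 2) (Fin 6) ℤ)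

/-- First `E₈(−1)` block of the sixteen `(−2)`-vectors `e a`. Local notation only. -/
local notation3 (prettyPrint := false) "AE1" =>
  (!![0, 0, 1, 0, 0, 0, 0, 1, 0, 1, 0, 0, -1, -2, 0, 0;
      0, 0, 1, 1, 0, 0, 1, 1, -1, 1, 0, 0, -1, -3, 0, 0;
      0, 0, 2, 1, 0, 0, 1, 2, -1, 2, 0, 0, -2, -3, 0, 0;
      0, 0, 2, 1, 0, 0, 2, 3, -2, 3, 0, 0, -2, -5, 0, 0;
      0, 0, 1, 1, 0, 0, 2, 2, -1, 3, 0, 0, -2, -4, 0, 0;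
      0, 0, 1, 1, 0, 0, 2, 2, 0, 2, 0, 0, -1, -3, 0, 0;
      0, 0, 1, 1, 0, 0, 1, 1, 0, 2, 0, 0, 0, -2, 0, 0;
      0, 0, 1, 0, 0, 0, 1, 0, 0, 1, 0, 0, 0, -1, 0, 0] : Matrix (Fin 8) (Fin 16) ℤ)

/-- Second `E₈(−1)` block of the sixteen `(−2)`-vectors `e a`. Local notation only. -/
local notation3 (prettyPrint := false) "AE2" =>
  (!![-1, -1, 0, 0, 1, 1, 0, 0, 0, 0, -1, 1, 0, 0, 1, 1;
      -1, -1, 0, 0, 1, 1, 0, 0, 0, 0, -1, 3, 0, 0, 1, 1;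
      -2, -2, 0, 0, 1, 1, 0, 0, 0, 0, -1, 3, 0, 0, 2, 2;
      -2, -3, 0, 0, 1, 2, 0, 0, 0, 0, -2, 5, 0, 0, 3, 2;
      -2, -2, 0, 0, 1, 1, 0, 0, 0, 0, -2, 4, 0, 0, 3, 1;
      -1, -1, 0, 0, 1, 1, 0, 0, 0, 0, -1, 3, 0, 0, 3, 1;
      0, -1, 0, 0, 1, 0, 0, 0, 0, 0, -1, 2, 0, 0, 2, 1;
      0, 0, 0, 0, 0, 0, 0, 0, 0, 0, -1, 1, 0, 0, 1, 1] : Matrix (Fin 8) (Fin 16) ℤ)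

/-- First `U` block of the sixteen `(−2)`-vectors `e a`. Local notation only. -/
local notation3 (prettyPrint := false) "CE1" =>
  (!![0, 0, 0, 0, 0, -1, 0, -1, 0, 0, 0, 0, 0, -1, 0, -1;
      0, 0, 0, 0, 0, 0, 0, 0, 0, 0, 0, 0, 0, 0, 0, 0] : Matrix (Fin 2) (Fin 16) ℤ)

/-- Second `U` block of the sixteen `(−2)`-vectors `e a`. Local notation only. -/
local notation3 (prettyPrint := false) "CE2" =>
  (!![0, 0, 0, 0, 0, 0, 0, 0, 0, 0, 0, 0, -1, -1, -1, -1;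
      0, 0, 0, 0, 0, 0, 0, 0, 0, 0, 0, 0, 0, 0, 0, 0] : Matrix (Fin 2) (Fin 16) ℤ)

/-- Third `U` block of the sixteen `(−2)`-vectors `e a`. Local notation only. -/
local notation3 (prettyPrint := false) "CE3" =>
  (!![0, 0, 0, 0, 0, 0, 0, 0, 0, -1, 0, -1, -1, 0, -1, 0;
      0, 0, 0, 0, 0, 0, 0, 0, 0, 0, 0, 0, 0, 0, 0, 0] : Matrix (Fin 2) (Fin 16) ℤ)

/-- The Gram matrix `U(2) ⊥ U(2) ⊥ U(2)` of the basis `u k s` (index `2k + s`). Local notation only. -/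
local notation3 (prettyPrint := false) "GU" =>
  (!![0, 2, 0, 0, 0, 0; 2, 0, 0, 0, 0, 0; 0, 0, 0, 2, 0, 0;
      0, 0, 2, 0, 0, 0; 0, 0, 0, 0, 0, 2; 0, 0, 0, 0, 2, 0] : Matrix (Fin 6) (Fin 6) ℤ)

/-- `FU : Matrix K3Index (Fin 6) ℤ`, columns = the `U(2)³` basis `u k s` at index `2k + s`. Local notation only. -/
local notation3 (prettyPrint := false) "FU" =>
  (Matrix.fromRows (Matrix.fromRows AU1 AU2) (Matrix.fromRows CU1 (Matrix.fromRows CU2 CU3)) :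
    Matrix K3Index (Fin 6) ℤ)

/-- `FE : Matrix K3Index (Fin 16) ℤ`, columns = the sixteen `(−2)`-vectors `e a`. Local notation only. -/
local notation3 (prettyPrint := false) "FE" =>
  (Matrix.fromRows (Matrix.fromRows AE1 AE2) (Matrix.fromRows CE1 (Matrix.fromRows CE2 CE3)) :
    Matrix K3Index (Fin 16) ℤ)

/-- The column index `2k + s : Fin 6` of `u k s`. Local notation only. -/
local notation3 (prettyPrint := false) "ι[" k ", " s "]" =>
  ((finProdFinEquiv : Fin 3 × Fin 2 ≃ Fin 6) ((k : Fin 3), (s : Fin 2)))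

/-- The frame `u : Fin 3 → Fin 2 → K3Index → ℤ` (columns of `FU`). Local notation only. -/
local notation3 (prettyPrint := false) "uF" =>
  (fun (k : Fin 3) (s : Fin 2) (i : K3Index) => FU i ι[k, s])

/-- The frame `e : Fin 16 → K3Index → ℤ` (columns of `FE`). Local notation only. -/
local notation3 (prettyPrint := false) "eF" => (fun (a : Fin 16) (i : K3Index) => FE i a)

/-! ## Gram matrix of the frame -/

/-- The integral form of two matrix columns is an entry of `Xᵀ Λ Y`. [folklore] -/
theorem intForm_col {α β : Type*} (X : Matrix K3Index α ℤ) (Y : Matrix K3Index β ℤ) (m : α)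
    (n : β) : IntForm[fun i => X i m, fun i => Y i n] = (Xᵀ * k3Gram * Y) m n := by
  rw [Matrix.mul_assoc]
  simp only [Matrix.mul_apply, Matrix.transpose_apply, Finset.mul_sum, mul_assoc]

/-- `Xᵀ Λ Y` for row-partitioned `X, Y` along `Λ = E₈(−1) ⊕ E₈(−1) ⊕ U ⊕ U ⊕ U` is the sum of the
five block products. [folklore] -/
theorem gram_blocks {α β : Type*} (X₁ X₂ : Matrix (Fin 8) α ℤ) (X₃ X₄ X₅ : Matrix (Fin 2) α ℤ)
    (Y₁ Y₂ : Matrix (Fin 8) β ℤ) (Y₃ Y₄ Y₅ : Matrix (Fin 2) β ℤ) :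
    (Matrix.fromRows (Matrix.fromRows X₁ X₂) (Matrix.fromRows X₃ (Matrix.fromRows X₄ X₅)))ᵀ *
        k3Gram * Matrix.fromRows (Matrix.fromRows Y₁ Y₂) (Matrix.fromRows Y₃ (Matrix.fromRows Y₄ Y₅)) =
      X₁ᵀ * (-CartanMatrix.E₈) * Y₁ + X₂ᵀ * (-CartanMatrix.E₈) * Y₂ +
        X₃ᵀ * hyperbolicPlaneGram * Y₃ + X₄ᵀ * hyperbolicPlaneGram * Y₄ +
        X₅ᵀ * hyperbolicPlaneGram * Y₅ := by
  simp only [k3Gram, Matrix.transpose_fromRows, Matrix.fromCols_mul_fromBlocks,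
    Matrix.fromCols_mul_fromRows, Matrix.mul_zero, add_zero, zero_add, add_assoc]

/-- `FUᵀ Λ FU = U(2)³` (kernel evaluation). [folklore] -/
theorem gram_uu : (AU1)ᵀ * (-CartanMatrix.E₈) * AU1 + (AU2)ᵀ * (-CartanMatrix.E₈) * AU2 +
    (CU1)ᵀ * hyperbolicPlaneGram * CU1 + (CU2)ᵀ * hyperbolicPlaneGram * CU2 +
    (CU3)ᵀ * hyperbolicPlaneGram * CU3 = GU := by
  decide

/-- `FUᵀ Λ FE = 0`: the `e a` are orthogonal to `U(2)³` (kernel evaluation). [folklore] -/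
theorem gram_ue : (AU1)ᵀ * (-CartanMatrix.E₈) * AE1 + (AU2)ᵀ * (-CartanMatrix.E₈) * AE2 +
    (CU1)ᵀ * hyperbolicPlaneGram * CE1 + (CU2)ᵀ * hyperbolicPlaneGram * CE2 +
    (CU3)ᵀ * hyperbolicPlaneGram * CE3 = 0 := by
  decide

/-- `FEᵀ Λ FE = −2·1`: the `e a` are pairwise orthogonal `(−2)`-vectors (kernel evaluation). [folklore] -/
theorem gram_ee : (AE1)ᵀ * (-CartanMatrix.E₈) * AE1 + (AE2)ᵀ * (-CartanMatrix.E₈) * AE2 +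
    (CE1)ᵀ * hyperbolicPlaneGram * CE1 + (CE2)ᵀ * hyperbolicPlaneGram * CE2 +
    (CE3)ᵀ * hyperbolicPlaneGram * CE3 =
      Matrix.of fun a b : Fin 16 => if a = b then (-2 : ℤ) else 0 := by
  decide

/-- Clause (1): `(u k s . u l t)` is the standard Gram matrix of `U(2)³`. [folklore] -/
theorem frame_uu (k l : Fin 3) (s t : Fin 2) :
    IntForm[fun i => FU i ι[k, s], fun i => FU i ι[l, t]] = if k = l ∧ s ≠ t then 2 else 0 := by
  rw [intForm_col, gram_blocks, gram_uu]
  revert k l s t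
  decide

/-- Clause (2): `(u k s . e a) = 0`. [folklore] -/
theorem frame_ue (k : Fin 3) (s : Fin 2) (a : Fin 16) :
    IntForm[fun i => FU i ι[k, s], fun i => FE i a] = 0 := by
  rw [intForm_col, gram_blocks, gram_ue]
  rfl

/-- Clause (3): `(e a . e b) = −2 δ_{ab}`. [folklore] -/
theorem frame_ee (a b : Fin 16) :
    IntForm[fun i => FE i a, fun i => FE i b] = if a = b then -2 else 0 := by
  rw [intForm_col, gram_blocks, gram_ee]
  rfl

/-! ## The `RM(1,4)` glue is integral -/

/-- Clause (4): the four half-sums `½ Σ_{Bit[k,a]=1} e_a` are lattice vectors (explicit `g`, kernel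
evaluation). [folklore] -/
theorem frame_glue (k : Fin 4) : ∃ g : K3Index → ℤ,
    2 • g = ∑ a : Fin 16, (if (Fin.val a / 2 ^ Fin.val k) % 2 = 1 then eF a else 0) := by
  fin_cases k
  · exact ⟨Sum.elim (Sum.elim ![0, 0, 1, 1, 1, 1, 1, 0] ![1, 2, 2, 3, 2, 2, 1, 1])
      (Sum.elim ![-2, 0] (Sum.elim ![-1, 0] ![-1, 0])), by decide⟩
  · exact ⟨Sum.elim (Sum.elim ![1, 2, 3, 4, 3, 3, 2, 1] ![1, 2, 3, 4, 3, 3, 2, 1])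
      (Sum.elim ![-1, 0] (Sum.elim ![-1, 0] ![-1, 0])), by decide⟩
  · exact ⟨Sum.elim (Sum.elim ![-1, -1, -1, -1, -1, 0, 0, 0] ![2, 2, 3, 4, 3, 3, 2, 1])
      (Sum.elim ![-2, 0] (Sum.elim ![-2, 0] ![-1, 0])), by decide⟩
  · exact ⟨Sum.elim (Sum.elim ![-1, -2, -2, -3, -2, -1, 0, 0] ![1, 2, 3, 4, 3, 3, 2, 1])
      (Sum.elim ![-1, 0] (Sum.elim ![-2, 0] ![-2, 0])), by decide⟩

/-- Clause (5): `½ Σ_a e_a` is a lattice vector. [folklore] -/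
theorem frame_glue_all : ∃ g : K3Index → ℤ, 2 • g = ∑ a : Fin 16, eF a :=
  ⟨Sum.elim (Sum.elim ![0, 0, 1, 1, 1, 2, 2, 1] ![1, 2, 2, 3, 2, 3, 2, 1])
      (Sum.elim ![-2, 0] (Sum.elim ![-2, 0] ![-2, 0])), by decide⟩

/-! ## Saturation: the glue of `⟨e_a⟩` is exactly `RM(1,4)` -/

/-- Clause (6): if `2v = Σ_a y_a e_a` with `v ∈ Λ` then `ȳ ∈ RM(1,4)`. Each coordinate `i` of the
identity is a parity check `Σ_a FE i a · y_a ≡ 0`; eleven rows of `FE` reduce mod 2 to a basis of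
`RM(2,4) = RM(1,4)^⊥`, and the sixteen affine conditions follow by linear arithmetic. [folklore] -/
theorem frame_saturated (v : K3Index → ℤ) (y : Fin 16 → ℤ)
    (h : 2 • v = ∑ a : Fin 16, y a • eF a) : AffineMod2[y] := by
  have key : ∀ i : K3Index, 2 * v i = ∑ a : Fin 16, y a * FE i a := fun i => by
    simpa only [Pi.smul_apply, Finset.sum_apply, smul_eq_mul, nsmul_eq_mul, Nat.cast_ofNat]
      using congrFun h i
  have r0 := key (Sum.inl (Sum.inl 0))
  have r1 := key (Sum.inl (Sum.inl 1))
  have r6 := key (Sum.inl (Sum.inl 6))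
  have r7 := key (Sum.inl (Sum.inl 7))
  have r8 := key (Sum.inl (Sum.inr 0))
  have r10 := key (Sum.inl (Sum.inr 2))
  have r14 := key (Sum.inl (Sum.inr 6))
  have r15 := key (Sum.inl (Sum.inr 7))
  have r16 := key (Sum.inr (Sum.inl 0))
  have r18 := key (Sum.inr (Sum.inr (Sum.inl 0)))
  have r20 := key (Sum.inr (Sum.inr (Sum.inr 0)))
  simp only [Fin.sum_univ_succ, Fin.sum_univ_zero, Fin.succ_zero_eq_one, Fin.succ_one_eq_two,
    Fin.reduceSucc, Matrix.fromRows_apply_inl, Matrix.fromRows_apply_inr, Matrix.of_apply,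
    Matrix.cons_val', Matrix.cons_val_zero, Matrix.cons_val_one, Matrix.cons_val,
    Matrix.empty_val', Matrix.cons_val_fin_one, mul_zero, mul_one, mul_neg, add_zero, zero_add]
    at r0 r1 r6 r7 r8 r10 r14 r15 r16 r18 r20
  refine ⟨y 0, ![y 1 - y 0, y 2 - y 0, y 4 - y 0, y 8 - y 0], fun a => ?_⟩
  clear key h
  fin_cases a <;> simp [Fin.sum_univ_four] <;> omega

/-! ## The stub -/

/-- **Stub 2a — `stub_kummerFrame`.** The tree's K3 lattice `Λ = (K3Index → ℤ, k3Gram) =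
E₈(−1)² ⊕ U³` contains a KUMMER FRAME `(u, e)`: `u k s` a standard basis of a `U(2)³`, `e a` sixteen
pairwise orthogonal `(−2)`-vectors orthogonal to `u`, the five `RM(1,4)` half-sums integral, and the
saturation of `⟨e⟩` glued EXACTLY by `RM(1,4)` (Nikulin 1975 / Morrison 1984 §3:
`H²(Km A, ℤ) ⊇ U(2)³ ⊕ K`, `K` primitive). Explicit frame: the columns of `FU`, `FE`.
[cite: Morrison1984, §3 (Kummer lattice)] -/
theorem stub_kummerFrame :
    ∃ (u : Fin 3 → Fin 2 → K3Index → ℤ) (e : Fin 16 → K3Index → ℤ), KummerFrame[u, e] :=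
  ⟨uF, eF, frame_uu, frame_ue, frame_ee, frame_glue, frame_glue_all, frame_saturated⟩

end Summit.HodgeConjecture.HodgeConjecture.Theorems.NikulinTwinTransport.KummerBkrQuaternionCarrier

end
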